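import Literature.AlgebraicGeometry.HodgeTheory.BettiUniverseAxioms
import Literature.AlgebraicGeometry.HodgeTheory.ComplexConjugationHolds
import Literature.AlgebraicGeometry.HodgeTheory.HodgeFiltrationModelsReductionProofs
import Literature.AlgebraicGeometry.HodgeTheory.HodgeRiemannPolarizabilityProofs
import HarnessLib

/-!
# The Betti–Hodge universe: the three hypotheses of the light axioms file DISCHARGED —
# Hodge decomposition, model-independence of `H^{p,q}`, and Hodge–Riemann for `H^{2,0}` of a surface

Family `hodge`, layer `Literature/AlgebraicGeometry/HodgeTheory`. Theorems only; the named fact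
`BettiUniverse.HodgeRiemann20` of `BettiUniverseAxioms` (light form) is PROVED here
(`BettiUniverse.HodgeRiemann20_holds`), and the other two hypotheses of that file are the tree's
theorems `exists_isReal_hodgeModel_holds` (`ComplexConjugationHolds`) and
`hodgePQ_independent_of_hodgeModel_holds` (`HodgeFiltrationModelsReductionProofs`), imported here;
so every statement of the light files `BettiUniverseAxioms` / `BettiUniverseCMAction` /
`BettiUniverseCMTypes` is available UNCONDITIONALLY from this (heavy) file, e.g.
`BettiUniverse.hodgeRiemann_two_zero_holds`. This file is deliberately NOT imported by the light
files (its import cone is the full Hodge-theory stack of the tree); a consumer who vendors the light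
files keeps the three hypotheses explicit and cites this file for their proofs.

Contents:

* `BettiUniverse.exists_realHodgeModel` — a smooth projective `X/ℂ` has a real Hodge model
  (`exists_isReal_hodgeModel_holds`);
* `BettiUniverse.isOfHodgeType_of_mem_hodgeStructure_F_self` — `Fᵏ(ℂ ⊗_ℚ Hᵏ) ⊆ Θ_A⁻¹(H^{k,0})`
  for the Hodge structure of ANY Hodge symmetric model `A` (the light file states it for the chosen
  model only);
* `BettiUniverse.cupProduct_eq_zero_of_types_surface` — every `(2,0)`-class on a surface is
  primitive: `κ ∪ ξ = 0` for `κ` of type `(1,1)`, `ξ` of type `(2,0)` (type `(3,1)` vanishes on a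
  surface; `HodgeModel.typePiece_eq_bot_of_lt_fst`), unconditionally;
* `BettiUniverse.tr_eq_smul_ratTopCoord`, `BettiUniverse.tr_ratTopVec_ne_zero`,
  `BettiUniverse.trC_eq_smul_cTopCoord` — the light trace `tr hX (2n)` (coordinate along the basis
  vector `lineBasis`, file `BettiUniverseAxioms`) is the NON-ZERO rational multiple
  `tr(v₀) • ratTopCoord` of the coordinate along the tree's generator `v₀ = ratTopVec hX` of the
  line `H^{2n}(X(ℂ); ℚ)` (`finrank_rat_top`), and its complexification is that multiple of the
  complex coordinate `cTopCoord` under `Θ'`;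
* `BettiUniverse.HodgeRiemann20_holds : BettiUniverse.HodgeRiemann20` — **Hodge–Riemann in
  bidegree `(2,0)` on a surface** (Voisin I Thm. 6.32, `k = 2`, `(p,q) = (2,0)`), for EVERY real
  Hodge model `A` and the light trace: from the tree's Hodge–Riemann relation on `X(ℂ)`
  (`KaehlerRationalDatum.hodgeRiemann_X`) for a Kähler–rational datum `D`
  (`nonempty_kaehlerRationalDatum`): `ξ = Θ'(η)` is of type `(2,0)`, non-zero, primitive, so
  `ξ ∪ ξ̄ = t · Ω` with `t > 0` and `Ω` the top Kähler class with `cTopCoord Ω ≠ 0`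
  (`KaehlerRationalDatum.cTopCoord_topClass_ne_zero`); `Θ'` is multiplicative
  (`BettiUniverse.ofRatClassBaseChange_cup2`) and commutes with conjugation
  (`KaehlerRationalDatum.ofRatClassBaseChange_conj`); and `trC = tr(v₀) · cTopCoord ∘ Θ'` with
  `tr(v₀) ≠ 0`;
* `BettiUniverse.hodgeRiemann_two_zero_holds` — the unconditional specialisation for the standard
  Hodge structure `hodge exists_isReal_hodgeModel_holds hX 2`.

## References

* [VoisinHodgeI2002] C. Voisin, *Hodge Theory and Complex Algebraic Geometry I*, CUP 2002, §6.1.3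
  Prop. 6.11 / Cor. 6.12, §6.2.3 Lemma 6.24, §6.3.2 Thm. 6.32 (held edition PDF p. 128), §7.1.1,
  §7.1.2.
* [HatcherAT2002] A. Hatcher, *Algebraic Topology*, CUP 2002, §3.3 Thm. 3.26 / Cor. 3.37.
* [GriffithsHarris1978] P. Griffiths, J. Harris, *Principles of Algebraic Geometry*, Wiley 1978,
  Ch. 0 §7 p. 123.
-/

noncomputable section

open scoped TensorProduct
open CategoryTheory Module
open Literature.AlgebraicTopology.SingularHomology
open Literature.Geometry.Kaehler (lefschetzPow lefschetzPow_succ lefschetzPow_zero lefschetzOperator_apply)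
open Literature.AlgebraicGeometry.Motives (bettiCohomology bettiCup ofRatClassBaseChange
  ofRatClassBaseChange_tmul)

namespace Literature.AlgebraicGeometry.HodgeTheory

namespace BettiUniverse

section Discharge

variable {n : ℕ} {X : Motives.SchemeOver ℂ}

/-- A smooth projective `X/ℂ` has a real Hodge model (the tree's theorem
`exists_isReal_hodgeModel_holds`: Serre's analytification, de Rham, the Hodge decomposition of the
compact Kähler manifold `X^an` with its real structure). [cite: VoisinHodgeI2002, §6.1.3 Prop. 6.11 and Cor. 6.12] -/
theorem exists_realHodgeModel (hX : Motives.IsSmoothProjective n X) : ∃ A : HodgeModel n X, A.IsReal :=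
  exists_isReal_hodgeModel_holds n X hX

/-- **`Fᵏ(ℂ ⊗_ℚ Hᵏ) ⊆ Θ_A⁻¹(H^{k,0})` for any Hodge symmetric model `A`**: an element of the last step
of the Hodge filtration of `A.hodgeStructure hX hA k` is, under `Θ'`, a class of Hodge type `(k,0)`.
[cite: VoisinHodgeI2002, §7.1.1 Def. 7.4] -/
theorem isOfHodgeType_of_mem_hodgeStructure_F_self (hX : Motives.IsSmoothProjective n X)
    (A : HodgeModel n X) (hA : A.IsHodgeSymmetric) (k : ℕ) {x : ℂ ⊗[ℚ] bettiCohomology X k}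
    (hx : x ∈ (A.hodgeStructure hX hA k).F k) :
    IsOfHodgeType n X k k 0 (ofRatClassBaseChange (Motives.ComplexPoints X) k x) := by
  refine ⟨A, ?_⟩
  rw [HodgeModel.hodgeStructure_F, HodgeModel.ratF_eq_iSup] at hx
  induction hx using Submodule.iSup_induction' with
  | mem pq x hx =>
    by_cases hk : (k : ℤ) ≤ (pq.1.1 : ℤ)
    · rw [iSup_pos hk, HodgeModel.mem_ratPiece_iff, HodgeModel.complexification_apply] at hx
      have hab : pq.1.1 + pq.1.2 = k := Finset.HasAntidiagonal.mem_antidiagonal.1 pq.2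
      have ha : pq.1.1 = k := by omega
      have hb : pq.1.2 = 0 := by omega
      rw [ha, hb] at hx
      exact hx
    · rw [iSup_neg hk, Submodule.mem_bot] at hx
      rw [hx, map_zero, map_zero]
      exact Submodule.zero_mem _
  | zero => rw [map_zero, map_zero]; exact Submodule.zero_mem _
  | add x y _ _ hx hy => rw [map_add, map_add]; exact Submodule.add_mem _ hx hy

/-- **Every `(2,0)`-class on a surface is primitive**: `κ ∪ ξ = 0` in `H⁴(X(ℂ); ℂ)` for `ξ` of type
`(2,0)` and `κ` of type `(1,1)` (the product has type `(3,1)`, and `H^{3,1} = 0` on a surface),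
unconditionally. [cite: VoisinHodgeI2002, §6.2.3 and §2.3.1] -/
theorem cupProduct_eq_zero_of_types_surface (hX : Motives.IsSmoothProjective 2 X)
    {κ : complexBetti X 2} {ξ : complexBetti X 2} (hκ : IsOfHodgeType 2 X 2 1 1 κ)
    (hξ : IsOfHodgeType 2 X 2 2 0 ξ) {m : ℕ} (h : 2 + 2 = m) : cupProduct h κ ξ = 0 := by
  have hI := hodgePQ_independent_of_hodgeModel_holds
  have hHD := exists_isReal_hodgeModel_holds
  have hL : IsOfHodgeType 2 X m (1 + 2) (1 + 0) (cupProduct h κ ξ) :=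
    cupPreservesHodgeType hHD hI hX h hκ hξ
  have hmem := (realHodgeModel hHD hX).mem_typePiece_of_isOfHodgeType hI hX
    (Finset.HasAntidiagonal.mem_antidiagonal.2 (by omega)) hL
  rwa [(realHodgeModel hHD hX).typePiece_eq_bot_of_lt_fst _ (by norm_num), Submodule.mem_bot] at hmem

/-! ### The light trace against the generator `v₀ = ratTopVec` of `H^{2n}(X(ℂ); ℚ)` -/

/-- **The light trace is a rational multiple of the coordinate along `v₀`**:
`tr = tr(v₀) • ratTopCoord` on the line `H^{2n}(X(ℂ); ℚ)` (`finrank_rat_top`). [folklore] -/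
theorem tr_eq_smul_ratTopCoord (hX : Motives.IsSmoothProjective n X) :
    tr hX (2 * n) = (tr hX (2 * n) (ratTopVec hX)) • ratTopCoord hX := by
  ext v
  conv_lhs => rw [← lineCoord_smul_self (ratTopVec hX) (ratTopVec_ne_zero hX) (finrank_rat_top hX) v]
  rw [map_smul, LinearMap.smul_apply, smul_eq_mul, smul_eq_mul, mul_comm]
  rfl

/-- **The light trace does not vanish on `v₀`** (it is a non-zero functional on the line
`H^{2n}(X(ℂ); ℚ)`, `tr_ne_zero` with `finrank_rat_top`). [folklore] -/
theorem tr_ratTopVec_ne_zero (hX : Motives.IsSmoothProjective n X) : tr hX (2 * n) (ratTopVec hX) ≠ 0 := by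
  intro h
  apply tr_ne_zero hX (finrank_rat_top hX)
  rw [tr_eq_smul_ratTopCoord hX, h, zero_smul]

/-- Pointwise form: `tr(z) = tr(v₀) · ratTopCoord(z)` on `H^{2n}(X(ℂ); ℚ)`. [folklore] -/
theorem tr_apply_eq (hX : Motives.IsSmoothProjective n X) (z : bettiCohomology X (2 * n)) :
    tr hX (2 * n) z = tr hX (2 * n) (ratTopVec hX) * ratTopCoord hX z := by
  have h := LinearMap.congr_fun (tr_eq_smul_ratTopCoord hX) z
  rw [LinearMap.smul_apply, smul_eq_mul] at h
  exact h

/-- **The complexified light trace against the complex coordinate**: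
`trC (w) = tr(v₀) · cTopCoord (Θ' w)` on `ℂ ⊗_ℚ H^{2n}(X(ℂ); ℚ)` (`cTopCoord_ofRatClass` on pure
tensors). [folklore] -/
theorem trC_eq_smul_cTopCoord (hX : Motives.IsSmoothProjective n X)
    (w : ℂ ⊗[ℚ] bettiCohomology X (2 * n)) :
    trC hX (2 * n) w = (tr hX (2 * n) (ratTopVec hX) : ℂ) *
      cTopCoord hX (ofRatClassBaseChange (Motives.ComplexPoints X) (2 * n) w) := by
  induction w using TensorProduct.induction_on with
  | zero => rw [map_zero, map_zero, map_zero, mul_zero]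
  | tmul c z =>
    rw [LinearMap.comp_apply, LinearMap.baseChange_tmul, LinearEquiv.coe_toLinearMap,
      TensorProduct.AlgebraTensorModule.rid_tmul, ofRatClassBaseChange_tmul, map_smul, cTopCoord_ofRatClass,
      tr_apply_eq hX z, Algebra.smul_def, smul_eq_mul, map_mul]
    simp only [eq_ratCast]
    ring
  | add x y hx hy => rw [map_add, hx, hy, map_add, map_add, mul_add]

/-! ### Hodge–Riemann for `(2,0)`-classes on a surface: the named fact discharged -/

/-- **`BettiUniverse.HodgeRiemann20` holds**: for `X` smooth projective of dimension `2`, every real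
Hodge model `A` and every non-zero `η ∈ F²(ℂ ⊗_ℚ H²(X(ℂ); ℚ))`, `trC hX 4 (η ∪ conj η) ≠ 0`.
Voisin I Thm. 6.32 ("the form `(-1)^{k(k-1)/2} i^{p-q-k} H_k` is positive definite on
`H^{p,q}_prim`") at `k = 2`, `(p,q) = (2,0)`, every `(2,0)`-class being primitive; proved from the
tree's `KaehlerRationalDatum.hodgeRiemann_X`. [cite: VoisinHodgeI2002, §6.3.2 Thm. 6.32]
[cite: GriffithsHarris1978, Ch. 0 §7 p. 123] -/
theorem HodgeRiemann20_holds : HodgeRiemann20 := by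
  intro X hX A hA η hη h0
  obtain ⟨D⟩ := nonempty_kaehlerRationalDatum hX
  set ξ : complexBetti X 2 := ofRatClassBaseChange (Motives.ComplexPoints X) 2 η with hξ_def
  -- `ξ` is of type `(2,0)` and non-zero
  have h20 : IsOfHodgeType 2 X 2 2 0 ξ :=
    isOfHodgeType_of_mem_hodgeStructure_F_self hX A hA.isHodgeSymmetric 2 hη
  have hξ0 : ξ ≠ 0 := fun h ↦ h0 (ofRatClassBaseChange_injective _ 2 (by rw [← hξ_def, h, map_zero]))
  -- `ξ` is primitive: `L ξ = η_D ∪ ξ` has type `(3,1)`, zero on a surface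
  have hprim : lefschetzPow D.Hη (0 + 1) 2 ξ = 0 := by
    rw [lefschetzPow_succ, LinearMap.comp_apply, lefschetzPow_zero, LinearMap.id_apply,
      lefschetzOperator_apply]
    exact cupProduct_eq_zero_of_types_surface hX D.isOfHodgeType_Hη h20 _
  -- Hodge–Riemann on `X(ℂ)`: `i^{2-0} (-1)^{1} (ξ ∪ ξ̄) = t • Ω`, `t > 0`
  obtain ⟨t, ht, heq⟩ := D.hodgeRiemann_X hX (a := 2) (s := 2) (t' := 0) (r₀ := 0) rfl rfl h20 hξ0 hprim
  rw [lefschetzPow_zero, LinearMap.id_apply] at heq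
  have hscal : (Complex.I ^ ((2 : ℕ) - (0 : ℕ) : ℤ) * (-1) ^ (2 * (2 - 1) / 2) : ℂ) = 1 := by
    norm_num [zpow_ofNat, Complex.I_sq]
  rw [hscal, one_smul] at heq
  -- the left-hand side, read in `H⁴(X(ℂ); ℂ)`
  have hcup : ofRatClassBaseChange (Motives.ComplexPoints X) (2 + 2)
      (LinearMap.BilinMap.baseChange ℂ (cup X 2 2) η (Motives.HodgeStructure.conj η)) =
        cupProduct rfl ξ (conjClass _ 2 ξ) := by
    rw [ofRatClassBaseChange_cup2, KaehlerRationalDatum.ofRatClassBaseChange_conj hX A]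
  have key : trC hX 4 (LinearMap.BilinMap.baseChange ℂ (cup X 2 2) η (Motives.HodgeStructure.conj η)) =
      (tr hX (2 * 2) (ratTopVec hX) : ℂ) * ((t : ℂ) * cTopCoord hX D.topClass) := by
    have e := trC_eq_smul_cTopCoord hX
      (LinearMap.BilinMap.baseChange ℂ (cup X 2 2) η (Motives.HodgeStructure.conj η))
    refine e.trans ?_
    change (tr hX (2 * 2) (ratTopVec hX) : ℂ) *
      cTopCoord hX (ofRatClassBaseChange (Motives.ComplexPoints X) (2 + 2) _) = _
    rw [hcup, heq, map_smul, smul_eq_mul]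
  rw [key]
  exact mul_ne_zero (by exact_mod_cast tr_ratTopVec_ne_zero hX)
    (mul_ne_zero (by exact_mod_cast ht.ne') (D.cTopCoord_topClass_ne_zero hX))

/-- **Hodge–Riemann in bidegree `(2,0)` on a surface, unconditionally**, for the standard Hodge
structure `hodge exists_isReal_hodgeModel_holds hX 2`: `trC hX 4 (η ∪ conj η) ≠ 0` for
`η ∈ F²(ℂ ⊗_ℚ H²(X(ℂ); ℚ))` non-zero, `dim X = 2`. [cite: VoisinHodgeI2002, §6.3.2 Thm. 6.32] -/
theorem hodgeRiemann_two_zero_holds (hX : Motives.IsSmoothProjective n X) (hn : n = 2)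
    (η : ℂ ⊗[ℚ] bettiCohomology X 2) (hη : η ∈ (hodge exists_isReal_hodgeModel_holds hX 2).F 2)
    (h0 : η ≠ 0) :
    trC hX 4 (LinearMap.BilinMap.baseChange ℂ (cup X 2 2) η (Motives.HodgeStructure.conj η)) ≠ 0 :=
  hodgeRiemann_two_zero exists_isReal_hodgeModel_holds HodgeRiemann20_holds hX hn η hη h0

end Discharge

end BettiUniverse

end Literature.AlgebraicGeometry.HodgeTheory

end
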